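import Mathlib
import HarnessLib
import Summits.HubbardSuperconductivity.HubbardSuperconductivity.Theorems.KLProgrammeC4aPPKernelModelWindow
import Summits.HubbardSuperconductivity.HubbardSuperconductivity.Theorems.KLProgrammeC4aPPKernelRatioForm
import Literature.MathematicalPhysics.QuantumLattice.MatsubaraTruncationRemainder

/-!
# Route `KLProgramme` — crux C4a, S3 brick (B4) «(B4)-UMK1», «(B3)-K MODEL WINDOW» part 2: the MODEL's finite-Matsubara-window pp pair kernel IS `P_M = P − R_M`
# (zero transfer frequency), and the REMAINDER LAW for the tail piece in the loop-circle headline's shape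

Cell `gate-hubbard-kl`, seat hubbard-kl-k3c3-p1 (g18; row «δμ-flow with klAngularMean constant piece»).  Companion of `…C4aPPKernelModelWindow` (part 1: `P = P_M + R_M`,
tails).  The lattice covariance symbol is `uvSymbolCT = uvSymbolFn (βL²) Λ e ω = Ψ̂` at the `2M` frequencies `matsubaraFreq β M i = π(2n+1)/β`, `n ∈ [−M,M)`
(`uvSymbolCT_eq_uvSymbolFn`, `uvSymbolFn_eq_uvSymbolFnXi`); at zero transfer frequency the pp partner of the line at `ωᵢ` sits at `−ωᵢ = ω_{rev i}` (`matsubaraFreq_rev`).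
* §4 `pair_resolvent_identity` (`1/((e−iω)(u+iω)) + 1/((e+iω)(u−iω)) = 2(eu+ω²)/((ω²+e²)(ω²+u²))`, NO `e+u` denominator), **`uvSymbolFnXi_pair_add`** (pairing `ω ↔ −ω`),
  **`matsubara_sum_pair_eq_ppWindowKernel`**: `(1/β)·Σ_{i : MatsubaraIdx M} Ψ̂_{ωᵢ}(e)·Ψ̂_{−ωᵢ}(u) = P_M(e,u)` (real, all levels; `sum_matsubaraIdx_freq_eq_sum_range`),
  `ppPairKernel_window_eq_ppWindowKernel` (the `…C4aPPKernelRatioForm` object over the window, `T = 1/β`, `Ω = 0`), **`matsubara_sum_pair_eq_true_sub_tail`**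
  (MODEL `= P − R_M`, `P = ppTrueKernel` = the object of every landed (U1) kernel row), `matsubara_sum_pair_re_im`, and the volume-normalised forms
  `matsubara_sum_uvSymbolFn_pair_eq` / `_rev_eq` (`Ψ_c = uvSymbolFn c`, `c = βL²`: `= c²·P_M`);
* §5 REMAINDER LAW: **`loopCircle_layer_le_of_deriv_le`** (generic: a kernel piece with `|∂ᵤKr| ≤ ε` on `|e| ≤ hi` contributes `≤ ℓN·(2hi)·(2π)·(W·Y₀·ε)` to
  `∫_{α₀}^{α₀+ℓN}|∫_{−hi}^{hi}∫_{v₀}^{v₀+2π} wt·(Y·∂ᵤKr(e, g))|` for ANY partner-level map `g`), `abs_deriv_ppTailKernel_div_le`, and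
  **`loopCircle_layer_ppTailKernel_le`** (`Kr = R_M/C`: `≤ ℓN·(2hi)·(2π)·W·Y₀·(8B₁/Λ + (5/2)(β/π))/(ω_M·C)`).
So the three one-partition one-calls for `P/C` (`…LoopCircleCanonical{,Perturbative}{FarS,MidS}{,Split}{,MF}` + the swap) plus this remainder give the first-order
ϑ-layer of the MODEL kernel `(P − R_M)/C`.  Pure real/complex analysis on Literature objects; nothing asserts (C), K3, the window or superconductivity.
References: BGM 2006 §2.1 (2.3)–(2.4), §2.4 (2.36) [cite: BenfattoGiulianiMastropietro2006]; Salmhofer 1999 §4.2.4 (4.63), §4.2.5 (4.70) [cite: Salmhofer1999].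
-/

noncomputable section

namespace Summit.HubbardSuperconductivity.HubbardSuperconductivity.Theorems.C4a

set_option linter.dupNamespace false -- summit = problem name (single-conjunct summit), D-0017

open Real Filter Set Finset Complex MeasureTheory intervalIntegral
open scoped Topology
open Literature.MathematicalPhysics.QuantumLattice Literature.Analysis.SpecialFunctions


/-! ## §4 The model identification at zero transfer frequency -/

/-- The weight is even in the frequency. [cite: Salmhofer1999, §4.2.5 (4.70)] -/
theorem uvWeightFn_neg_freq (Λ ω x : ℝ) : uvWeightFn Λ (-ω) x = uvWeightFn Λ ω x := by
  unfold uvWeightFn; rw [neg_sq]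

/-- The resolvent pairing identity: `1/((e−iω)(u+iω)) + 1/((e+iω)(u−iω)) = 2(eu+ω²)/((ω²+e²)(ω²+u²))` (`ω ≠ 0`). [folklore] -/
theorem pair_resolvent_identity {ω : ℝ} (hω : ω ≠ 0) (e u : ℝ) :
    (1 : ℂ) / (-I * (ω : ℂ) + e) * (1 / (-I * -(ω : ℂ) + u)) + 1 / (-I * -(ω : ℂ) + e) * (1 / (-I * (ω : ℂ) + u)) =
      ((2 * ((e * u + ω ^ 2) / ((ω ^ 2 + e ^ 2) * (ω ^ 2 + u ^ 2))) : ℝ) : ℂ) := by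
  have hI : Complex.I ^ 2 = -1 := Complex.I_sq
  have hne : ∀ (s : ℝ) (x : ℝ), s = 1 ∨ s = -1 → (-I * ((s : ℂ) * ω) + x) ≠ 0 := by
    intro s x hs h
    have him := congrArg Complex.im h
    simp at him
    rcases hs with rfl | rfl <;> simp at him <;> exact hω (by linarith)
  have ha : (-I * (ω : ℂ) + e) ≠ 0 := by simpa using hne 1 e (Or.inl rfl)
  have hb : (-I * -(ω : ℂ) + u) ≠ 0 := by simpa using hne (-1) u (Or.inr rfl)
  have hc : (-I * -(ω : ℂ) + e) ≠ 0 := by simpa using hne (-1) e (Or.inr rfl)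
  have hd : (-I * (ω : ℂ) + u) ≠ 0 := by simpa using hne 1 u (Or.inl rfl)
  have key1 : (-I * (ω : ℂ) + e) * (-I * -(ω : ℂ) + e) = (ω : ℂ) ^ 2 + e ^ 2 := by linear_combination (-(ω : ℂ) ^ 2) * hI
  have key2 : (-I * -(ω : ℂ) + u) * (-I * (ω : ℂ) + u) = (ω : ℂ) ^ 2 + u ^ 2 := by linear_combination (-(ω : ℂ) ^ 2) * hI
  have hnum : (-I * (ω : ℂ) + e) * (-I * -(ω : ℂ) + u) + (-I * -(ω : ℂ) + e) * (-I * (ω : ℂ) + u) = 2 * ((e : ℂ) * u + (ω : ℂ) ^ 2) := by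
    linear_combination (-2 * (ω : ℂ) ^ 2) * hI
  have hden : (-I * (ω : ℂ) + e) * (-I * -(ω : ℂ) + u) * ((-I * -(ω : ℂ) + e) * (-I * (ω : ℂ) + u)) = ((ω : ℂ) ^ 2 + e ^ 2) * ((ω : ℂ) ^ 2 + u ^ 2) := by
    calc (-I * (ω : ℂ) + e) * (-I * -(ω : ℂ) + u) * ((-I * -(ω : ℂ) + e) * (-I * (ω : ℂ) + u))
        = ((-I * (ω : ℂ) + e) * (-I * -(ω : ℂ) + e)) * ((-I * -(ω : ℂ) + u) * (-I * (ω : ℂ) + u)) := by ring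
      _ = ((ω : ℂ) ^ 2 + e ^ 2) * ((ω : ℂ) ^ 2 + u ^ 2) := by rw [key1, key2]
  rw [one_div_mul_one_div, one_div_mul_one_div, one_div_add_one_div (mul_ne_zero ha hb) (mul_ne_zero hc hd), hnum, hden]
  push_cast
  ring

/-- The weight's cast is even in the frequency (for rewriting under `↑`). [cite: Salmhofer1999, §4.2.5 (4.70)] -/
theorem uvWeightFn_neg_freq_cast (Λ ω x : ℝ) : ((uvWeightFn Λ (-ω) x : ℝ) : ℂ) = ((uvWeightFn Λ ω x : ℝ) : ℂ) := by
  rw [uvWeightFn_neg_freq]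

/-- **PAIRING `ω ↔ −ω`**: `Ψ̂_ω(e)Ψ̂_{−ω}(u) + Ψ̂_{−ω}(e)Ψ̂_ω(u) = 2·W(ω,e)W(ω,u)·(eu+ω²)/((ω²+e²)(ω²+u²))` (`ω ≠ 0`; the two products are complex
conjugates — NO `e+u` denominator). [cite: BenfattoGiulianiMastropietro2006, §2.1 (2.3)] -/
theorem uvSymbolFnXi_pair_add {Λ ω : ℝ} (hω : ω ≠ 0) (e u : ℝ) :
    uvSymbolFnXi 1 Λ ω e * uvSymbolFnXi 1 Λ (-ω) u + uvSymbolFnXi 1 Λ (-ω) e * uvSymbolFnXi 1 Λ ω u =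
      ((2 * (uvWeightFn Λ ω e * uvWeightFn Λ ω u * ((e * u + ω ^ 2) / ((ω ^ 2 + e ^ 2) * (ω ^ 2 + u ^ 2)))) : ℝ) : ℂ) := by
  have h4 := pair_resolvent_identity hω e u
  unfold uvSymbolFnXi resolventFnXi
  rw [uvWeightFn_neg_freq_cast, uvWeightFn_neg_freq_cast]
  simp only [add_zero]
  push_cast
  calc ((uvWeightFn Λ ω e : ℝ) : ℂ) * (1 / (-I * (ω : ℂ) + e)) * (((uvWeightFn Λ ω u : ℝ) : ℂ) * (1 / (-I * -(ω : ℂ) + u))) +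
        ((uvWeightFn Λ ω e : ℝ) : ℂ) * (1 / (-I * -(ω : ℂ) + e)) * (((uvWeightFn Λ ω u : ℝ) : ℂ) * (1 / (-I * (ω : ℂ) + u)))
      = ((uvWeightFn Λ ω e : ℝ) : ℂ) * ((uvWeightFn Λ ω u : ℝ) : ℂ) *
          ((1 : ℂ) / (-I * (ω : ℂ) + e) * (1 / (-I * -(ω : ℂ) + u)) + 1 / (-I * -(ω : ℂ) + e) * (1 / (-I * (ω : ℂ) + u))) := by ring
    _ = ((uvWeightFn Λ ω e : ℝ) : ℂ) * ((uvWeightFn Λ ω u : ℝ) : ℂ) * ((2 * ((e * u + ω ^ 2) / ((ω ^ 2 + e ^ 2) * (ω ^ 2 + u ^ 2))) : ℝ) : ℂ) := by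
          rw [h4]
    _ = _ := by push_cast; ring

/-- **THE MODEL'S WINDOW KERNEL IS `P_M`**: over the lattice's `2M` fermionic frequencies `ωᵢ = π(2n+1)/β`, `n ∈ [−M,M)`, at zero transfer frequency,
`(1/β)·Σᵢ Ψ̂_{ωᵢ}(e)·Ψ̂_{−ωᵢ}(u) = P_M(e,u)` — real, no `e+u` denominator, for ALL levels. [cite: BenfattoGiulianiMastropietro2006, §2.1 (2.3)-(2.4)] -/
theorem matsubara_sum_pair_eq_ppWindowKernel {β : ℝ} (hβ : 0 < β) (Λ : ℝ) (M : ℕ) (e u : ℝ) :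
    ((1 / β : ℝ) : ℂ) * ∑ i : MatsubaraIdx M, uvSymbolFnXi 1 Λ (matsubaraFreq β M i) e * uvSymbolFnXi 1 Λ (-matsubaraFreq β M i) u =
      ((ppWindowKernel β Λ M e u : ℝ) : ℂ) := by
  rw [sum_matsubaraIdx_freq_eq_sum_range β M (fun ω => uvSymbolFnXi 1 Λ ω e * uvSymbolFnXi 1 Λ (-ω) u)]
  simp only [neg_neg]
  rw [← Finset.sum_add_distrib]
  have hpair : ∀ n ∈ Finset.range M, uvSymbolFnXi 1 Λ ((2 * n + 1) * π / β) e * uvSymbolFnXi 1 Λ (-((2 * n + 1) * π / β)) u +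
      uvSymbolFnXi 1 Λ (-((2 * n + 1) * π / β)) e * uvSymbolFnXi 1 Λ ((2 * n + 1) * π / β) u = ((2 * ppKernelSummand β Λ e u n : ℝ) : ℂ) := by
    intro n _
    have hω : ppFreq β n ≠ 0 := (ppFreq_pos hβ n).ne'
    exact uvSymbolFnXi_pair_add (Λ := Λ) hω e u
  rw [Finset.sum_congr rfl hpair]
  unfold ppWindowKernel
  push_cast
  rw [Finset.mul_sum, Finset.mul_sum]
  refine Finset.sum_congr rfl fun n _ => ?_
  have hβ0 : (β : ℂ) ≠ 0 := by exact_mod_cast hβ.ne'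
  field_simp

/-- `matsubaraFreq β M` is injective (`β ≠ 0`). [folklore] -/
theorem matsubaraFreq_injective {β : ℝ} (hβ : β ≠ 0) (M : ℕ) : Function.Injective (matsubaraFreq β M) := by
  intro i j h
  unfold matsubaraFreq matsubaraInt at h
  have hπ := Real.pi_ne_zero
  have h1 : (2 * (((i : ℤ) - M : ℤ) : ℝ) + 1) = (2 * (((j : ℤ) - M : ℤ) : ℝ) + 1) := by
    have := congrArg (fun x => x * β / π) h
    field_simp at this
    push_cast at this ⊢
    linarith
  have h2 : ((i : ℕ) : ℝ) = ((j : ℕ) : ℝ) := by push_cast at h1; linarith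
  exact Fin.ext (by exact_mod_cast h2)

/-- **`ppPairKernel` FORM**: the pair kernel of `…C4aPPKernelRatioForm` over the model's window `S_M = {ωᵢ}`, `T = 1/β`, `Ω = 0`, is `P_M`.
[cite: BenfattoGiulianiMastropietro2006, §2.1 (2.3)-(2.4)] -/
theorem ppPairKernel_window_eq_ppWindowKernel {β : ℝ} (hβ : 0 < β) (Λ : ℝ) (M : ℕ) (e u : ℝ) :
    ppPairKernel ((Finset.univ : Finset (MatsubaraIdx M)).image (matsubaraFreq β M)) (1 / β) Λ 0 e u = ((ppWindowKernel β Λ M e u : ℝ) : ℂ) := by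
  unfold ppPairKernel
  rw [Finset.sum_image fun i _ j _ h => matsubaraFreq_injective hβ.ne' M h, ← matsubara_sum_pair_eq_ppWindowKernel hβ Λ M e u]
  simp only [zero_sub]

/-- **THE MODEL KERNEL IS `P − R_M`**: `(1/β)·Σᵢ Ψ̂_{ωᵢ}(e)Ψ̂_{−ωᵢ}(u) = P(e,u) − R_M(e,u)` with `P = ppTrueKernel β Λ` (the object of every landed (U1) kernel row)
and the tail `R_M` of §3 (`|R_M| ≤ 2/ω_M`, `|∂R_M| ≤ (8B₁/Λ + (5/2)(β/π))/ω_M`). [cite: BenfattoGiulianiMastropietro2006, §2.1 (2.3)-(2.4)] -/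
theorem matsubara_sum_pair_eq_true_sub_tail {β : ℝ} (hβ : 0 < β) (Λ : ℝ) (M : ℕ) (e u : ℝ) :
    ((1 / β : ℝ) : ℂ) * ∑ i : MatsubaraIdx M, uvSymbolFnXi 1 Λ (matsubaraFreq β M i) e * uvSymbolFnXi 1 Λ (-matsubaraFreq β M i) u =
      ((ppTrueKernel β Λ e u - ppTailKernel β Λ M e u : ℝ) : ℂ) := by
  rw [matsubara_sum_pair_eq_ppWindowKernel hβ Λ M e u, ppTrueKernel_eq_window_add_tail hβ Λ M e u, add_sub_cancel_right]

/-- **REAL PART / IMAGINARY PART form** for consumers working over `ℝ`: the model sum has real part `P_M = P − R_M` and imaginary part `0`.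
[cite: BenfattoGiulianiMastropietro2006, §2.1 (2.3)-(2.4)] -/
theorem matsubara_sum_pair_re_im {β : ℝ} (hβ : 0 < β) (Λ : ℝ) (M : ℕ) (e u : ℝ) :
    (((1 / β : ℝ) : ℂ) * ∑ i : MatsubaraIdx M, uvSymbolFnXi 1 Λ (matsubaraFreq β M i) e * uvSymbolFnXi 1 Λ (-matsubaraFreq β M i) u).re =
        ppTrueKernel β Λ e u - ppTailKernel β Λ M e u ∧
      (((1 / β : ℝ) : ℂ) * ∑ i : MatsubaraIdx M, uvSymbolFnXi 1 Λ (matsubaraFreq β M i) e * uvSymbolFnXi 1 Λ (-matsubaraFreq β M i) u).im = 0 := by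
  rw [matsubara_sum_pair_eq_true_sub_tail hβ Λ M e u]
  exact ⟨Complex.ofReal_re _, Complex.ofReal_im _⟩

/-- **Frequency-parametrised, volume-normalised form**: `(1/β)·Σᵢ Ψ_c(e,ωᵢ)Ψ_c(u,−ωᵢ) = c²·P_M(e,u)` with `Ψ_c = uvSymbolFn c Λ` (`c = βL²` is the
normalisation of the lattice symbol `uvSymbolCT`, `uvSymbolCT_eq_uvSymbolFn`). [cite: Salmhofer1999, §4.2.5 (4.70)] -/
theorem matsubara_sum_uvSymbolFn_pair_eq {β : ℝ} (hβ : 0 < β) (c Λ : ℝ) (M : ℕ) (e u : ℝ) :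
    ((1 / β : ℝ) : ℂ) * ∑ i : MatsubaraIdx M, uvSymbolFn c Λ e (matsubaraFreq β M i) * uvSymbolFn c Λ u (-matsubaraFreq β M i) =
      ((c ^ 2 * ppWindowKernel β Λ M e u : ℝ) : ℂ) := by
  have hscale : ∀ x ω : ℝ, uvSymbolFn c Λ x ω = (c : ℂ) * uvSymbolFnXi 1 Λ ω x := fun x ω => by
    rw [uvSymbolFn_eq_uvSymbolFnXi]; unfold uvSymbolFnXi resolventFnXi; push_cast; ring
  simp_rw [hscale]
  have h := matsubara_sum_pair_eq_ppWindowKernel hβ Λ M e u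
  calc ((1 / β : ℝ) : ℂ) * ∑ i : MatsubaraIdx M, (c : ℂ) * uvSymbolFnXi 1 Λ (matsubaraFreq β M i) e * ((c : ℂ) * uvSymbolFnXi 1 Λ (-matsubaraFreq β M i) u)
      = (c : ℂ) ^ 2 * (((1 / β : ℝ) : ℂ) * ∑ i : MatsubaraIdx M, uvSymbolFnXi 1 Λ (matsubaraFreq β M i) e * uvSymbolFnXi 1 Λ (-matsubaraFreq β M i) u) := by
        rw [Finset.mul_sum, Finset.mul_sum, Finset.mul_sum]
        exact Finset.sum_congr rfl fun i _ => by ring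
    _ = ((c ^ 2 * ppWindowKernel β Λ M e u : ℝ) : ℂ) := by rw [h]; push_cast; ring

/-- The same with the partner's frequency written as the REFLECTED index `i.rev` (`ω_{rev i} = −ωᵢ`, `matsubaraFreq_rev`), the form in which the lattice pp
bubble at zero transfer frequency presents its frequency sum. [cite: Salmhofer1999, §4.2.4 (4.63)] -/
theorem matsubara_sum_uvSymbolFn_pair_rev_eq {β : ℝ} (hβ : 0 < β) (c Λ : ℝ) (M : ℕ) (e u : ℝ) :
    ((1 / β : ℝ) : ℂ) * ∑ i : MatsubaraIdx M, uvSymbolFn c Λ e (matsubaraFreq β M i) * uvSymbolFn c Λ u (matsubaraFreq β M i.rev) =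
      ((c ^ 2 * ppWindowKernel β Λ M e u : ℝ) : ℂ) := by
  simp only [matsubaraFreq_rev]; exact matsubara_sum_uvSymbolFn_pair_eq hβ c Λ M e u

/-! ## §5 The remainder law: a kernel piece with a uniformly small `u`-gradient in the loop-circle headline's LHS shape -/

/-- **REMAINDER LAW (generic)**: if `|∂ᵤKr(e,·)| ≤ ε` for the loop levels `|e| ≤ hi`, the level weight is `0 ≤ wt ≤ W` and the loop numerator `|Y| ≤ Y₀` there, then for
ANY partner-level map `g` the first-order layer integral over a relative-angle interval of length `ℓN ≥ 0` is at most `ℓN·(2hi)·(2π)·(W·Y₀·ε)` — pointwise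
majorants times lengths, no measurability needed. [cite: BenfattoGiulianiMastropietro2006, §2.4 (2.36)] -/
theorem loopCircle_layer_le_of_deriv_le {Kr : ℝ → ℝ → ℝ} {ε hi : ℝ} (hhi : 0 ≤ hi)
    (hK : ∀ e ∈ Icc (-hi) hi, ∀ u : ℝ, |deriv (fun v : ℝ => Kr e v) u| ≤ ε)
    {wt : ℝ → ℝ} {W : ℝ} (hw0 : ∀ e ∈ Icc (-hi) hi, 0 ≤ wt e) (hwW : ∀ e ∈ Icc (-hi) hi, wt e ≤ W)
    {Y : ℝ → ℝ → ℝ} {Y₀ : ℝ} (hYb : ∀ e ∈ Icc (-hi) hi, ∀ v, |Y e v| ≤ Y₀)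
    (g : ℝ → ℝ → ℝ → ℝ) (α₀ v₀ : ℝ) {ℓN : ℝ} (hℓ : 0 ≤ ℓN) :
    ∫ ϑ in α₀..(α₀ + ℓN), |∫ e in (-hi)..hi, ∫ v in v₀..(v₀ + 2 * π), wt e * (Y e v * deriv (fun v : ℝ => Kr e v) (g ϑ e v))| ≤
      ℓN * (2 * hi) * (2 * π) * (W * Y₀ * ε) := by
  have hW : 0 ≤ W := by
    have h0 : (0 : ℝ) ∈ Icc (-hi) hi := ⟨by linarith, hhi⟩
    exact (hw0 0 h0).trans (hwW 0 h0)
  have hY₀ : 0 ≤ Y₀ := by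
    have h0 : (0 : ℝ) ∈ Icc (-hi) hi := ⟨by linarith, hhi⟩
    exact (abs_nonneg _).trans (hYb 0 h0 0)
  -- innermost: the loop circle
  have hinner : ∀ ϑ, ∀ e ∈ Icc (-hi) hi, ‖∫ v in v₀..(v₀ + 2 * π), wt e * (Y e v * deriv (fun v : ℝ => Kr e v) (g ϑ e v))‖ ≤ W * Y₀ * ε * (2 * π) := by
    intro ϑ e he
    have hb : ∀ v ∈ Set.uIoc v₀ (v₀ + 2 * π), ‖wt e * (Y e v * deriv (fun v : ℝ => Kr e v) (g ϑ e v))‖ ≤ W * Y₀ * ε := by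
      intro v _
      rw [Real.norm_eq_abs, abs_mul, abs_mul, abs_of_nonneg (hw0 e he)]
      calc wt e * (|Y e v| * |deriv (fun v : ℝ => Kr e v) (g ϑ e v)|) ≤ W * (Y₀ * ε) :=
            mul_le_mul (hwW e he) (mul_le_mul (hYb e he v) (hK e he _) (abs_nonneg _) hY₀) (by positivity) hW
        _ = W * Y₀ * ε := by ring
    have h := intervalIntegral.norm_integral_le_of_norm_le_const hb
    have hlen : |v₀ + 2 * π - v₀| = 2 * π := by rw [add_sub_cancel_left, abs_of_pos Real.two_pi_pos]
    rwa [hlen] at h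
  -- middle: the loop levels
  have hmid : ∀ ϑ, |∫ e in (-hi)..hi, ∫ v in v₀..(v₀ + 2 * π), wt e * (Y e v * deriv (fun v : ℝ => Kr e v) (g ϑ e v))| ≤
      W * Y₀ * ε * (2 * π) * (2 * hi) := by
    intro ϑ
    have hb : ∀ e ∈ Set.uIoc (-hi) hi, ‖∫ v in v₀..(v₀ + 2 * π), wt e * (Y e v * deriv (fun v : ℝ => Kr e v) (g ϑ e v))‖ ≤ W * Y₀ * ε * (2 * π) := by
      intro e he
      rw [Set.uIoc_of_le (by linarith : -hi ≤ hi)] at he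
      exact hinner ϑ e ⟨he.1.le, he.2⟩
    have h := intervalIntegral.norm_integral_le_of_norm_le_const hb
    have hlen : |hi - -hi| = 2 * hi := by rw [sub_neg_eq_add, abs_of_nonneg (by linarith)]; ring
    rw [hlen, Real.norm_eq_abs] at h
    exact h
  -- outer: the relative angle
  have hb : ∀ ϑ ∈ Set.uIoc α₀ (α₀ + ℓN), ‖|∫ e in (-hi)..hi, ∫ v in v₀..(v₀ + 2 * π), wt e * (Y e v * deriv (fun v : ℝ => Kr e v) (g ϑ e v))|‖ ≤
      W * Y₀ * ε * (2 * π) * (2 * hi) := fun ϑ _ => by rw [Real.norm_eq_abs, abs_abs]; exact hmid ϑ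
  have h := intervalIntegral.norm_integral_le_of_norm_le_const hb
  have hlen : |α₀ + ℓN - α₀| = ℓN := by rw [add_sub_cancel_left, abs_of_nonneg hℓ]
  rw [hlen, Real.norm_eq_abs] at h
  have hfin := (le_abs_self _).trans h
  calc _ ≤ W * Y₀ * ε * (2 * π) * (2 * hi) * ℓN := hfin
    _ = ℓN * (2 * hi) * (2 * π) * (W * Y₀ * ε) := by ring

/-- `|∂ᵤ(R_M/C)| ≤ (tail constant)/(C·ω_M)` — the normalised piece (the one-partition one-calls carry the kernel as `·/C`). [cite: BenfattoGiulianiMastropietro2006, §2.1 (2.3)-(2.4)] -/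
theorem abs_deriv_ppTailKernel_div_le {β Λ : ℝ} (hβ : 0 < β) (hΛ : 0 < Λ) {B₁ : ℝ} (hB₁ : ∀ x, |deriv salmhoferCutoff x| ≤ B₁) (M : ℕ) {C : ℝ} (hC : 0 < C)
    (e u : ℝ) : |deriv (fun v : ℝ => ppTailKernel β Λ M e v / C) u| ≤ (8 * B₁ / Λ + 5 / 2 * (β / π)) / ppFreq β M / C := by
  have hd : HasDerivAt (fun v : ℝ => ppTailKernel β Λ M e v / C) (ppTailKernelDu β Λ M e u / C) u := (hasDerivAt_ppTailKernel_u hβ hΛ hB₁ M e u).div_const C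
  rw [hd.deriv, abs_div, abs_of_pos hC]
  exact div_le_div_of_nonneg_right (abs_ppTailKernelDu_le hβ hΛ hB₁ M e u) hC.le

/-- **THE REMAINDER LAW FOR `R_M/C`**: the tail piece of the MODEL kernel contributes at most `ℓN·(2hi)·(2π)·W·Y₀·(8B₁/Λ + (5/2)(β/π))/(ω_M·C)` to the loop-circle
first-order layer, for ANY partner-level map (in the headlines `g ϑ e v = e_K(S_{ρϑθ}(0) − Φ(e, v+θ))`), any loop numerator `|Y| ≤ Y₀` and level weight
`0 ≤ wt ≤ W` on `|e| ≤ hi`.  With the three one-partition one-calls (`…FarS`, swap, `…MidS`) for `P/C` this is the fourth and last piece of the model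
kernel `(P − R_M)/C`. [cite: BenfattoGiulianiMastropietro2006, §2.4 (2.36)] -/
theorem loopCircle_layer_ppTailKernel_le {β Λ : ℝ} (hβ : 0 < β) (hΛ : 0 < Λ) {B₁ : ℝ} (hB₁ : ∀ x, |deriv salmhoferCutoff x| ≤ B₁) (M : ℕ) {C : ℝ} (hC : 0 < C)
    {hi : ℝ} (hhi : 0 ≤ hi) {wt : ℝ → ℝ} {W : ℝ} (hw0 : ∀ e ∈ Icc (-hi) hi, 0 ≤ wt e) (hwW : ∀ e ∈ Icc (-hi) hi, wt e ≤ W)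
    {Y : ℝ → ℝ → ℝ} {Y₀ : ℝ} (hYb : ∀ e ∈ Icc (-hi) hi, ∀ v, |Y e v| ≤ Y₀) (g : ℝ → ℝ → ℝ → ℝ) (α₀ v₀ : ℝ) {ℓN : ℝ} (hℓ : 0 ≤ ℓN) :
    ∫ ϑ in α₀..(α₀ + ℓN), |∫ e in (-hi)..hi, ∫ v in v₀..(v₀ + 2 * π), wt e * (Y e v * deriv (fun v : ℝ => ppTailKernel β Λ M e v / C) (g ϑ e v))| ≤
      ℓN * (2 * hi) * (2 * π) * (W * Y₀ * ((8 * B₁ / Λ + 5 / 2 * (β / π)) / ppFreq β M / C)) := by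
  have hB0 := salmhoferB₁_nonneg hB₁
  have hωM := ppFreq_pos hβ M
  exact loopCircle_layer_le_of_deriv_le (Kr := fun e v => ppTailKernel β Λ M e v / C) hhi
    (fun e _ u => abs_deriv_ppTailKernel_div_le hβ hΛ hB₁ M hC e u) hw0 hwW hYb g α₀ v₀ hℓ

end Summit.HubbardSuperconductivity.HubbardSuperconductivity.Theorems.C4a

end
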